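import Summits.CriticalPhenomena.PercolationContinuityZ3.Theorems.PercNearOneGluingNoHeavyLowerTailSahiTwoChainWRChain
import Literature.Combinatorics.Sahi2008.UniformSquareAllOrders
import HarnessLib

/-!
# The Lieb–Sahi induction for `Ẽ_n`, I: the averaging step, `A(n)`, and `A(n) ⟹ B(n)`

Support file of the one-cut programme (crux `NoHeavyLowerTail`, stmt-CriticalPhenomena-4575; cell `prim-masterthm`, seat P3, gen 16;
`run/shared/lean/prim/prim-masterthm/prim-masterthm-p3/HIERARCHY.md` §24; memo
`run/shared/lean/prim/prim-masterthm/FROM-prim-masterthm-p3-g16-TWO-CHAIN-COEFFICIENTS.md`).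

Lieb–Sahi prove `E_n ≥ 0` for staircase indicators on the uniform square grid by a joint induction on `n` of three statements
`A(n)`, `B(n)`, `C(n)` [LiebSahi2021, §3.4, Thms. 3.11–3.13] (tree: `Sahi2008/UniformSquareAllOrders.lean`).  This file and its
sequel run THE SAME INDUCTION for the without-replacement functional `Ẽ_n = SahiTwoChain.et univ univ n` on the square grids
`Fin m × Fin m`, for ALL `m ≥ n` simultaneously (the product term of the recursion of `Ẽ` lives on the reduced grid, which is the
full grid of size `m − 1`: `et_erase_univ_eq`, `exists_stair_comp_succAbove`).  Here:
* `et_update_aPlus_add_aMinus` — Proposition 3.10 for `Ẽ`: `Ẽ(…a⁺…) + Ẽ(…a⁻…) = 2Ẽ(…a…)` when only `a` has a descent at `p`;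
  for `Ẽ` this is the invariance under the transposition of the columns `p, p+1` (`et_comp_equiv`), which fixes every other staircase.
* `et_disjoint_nonpos_zero`, `et_disjoint_nonpos_succ` — `A(2)` and the step `A(n−1) ∧ C(n−1) ⟹ A(n)` (with `C(n−1)` on the
  smaller grid).
* `et_update_aStar_le` — `A(n) ⟹ B(n)` (Lemma 2.7, verbatim).
Everything PROVED, standard axioms; no new definitions. [this work]
-/

noncomputable section

open scoped Classical

namespace Summit.CriticalPhenomena.PercolationContinuityZ3.Theorems

open Finset Function
open Literature.Combinatorics.Sahi2008

namespace SahiTwoChain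

/-! ## The Lieb–Sahi induction [LiebSahi2021, §3.4] for `Ẽ_n` on the square grid `Fin m × Fin m` -/

section Grid

open Literature.Combinatorics.Sahi2008.LiebSahiGrid

variable {m : ℕ}

/-- `χ_∅ = 0` (plumbing). [this work] -/
private theorem setInd_empty_eq_zero' {γ : Type*} [DecidableEq γ] : setInd (∅ : Finset γ) = 0 := by
  funext x
  simp [setInd_apply]

/-! ### Restriction of staircases to a reduced grid -/

/-- Restricting a staircase indicator of the `(m+1) × (m+1)` grid along `x.succAbove × y.succAbove` (deleting column `x` and
row `y`) gives a staircase indicator of the `m × m` grid. [this work] -/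
theorem exists_stair_comp_succAbove {m : ℕ} {a : Fin (m + 1) → ℕ} (ha : IsStair (m + 1) a) (x y : Fin (m + 1)) :
    ∃ a' : Fin m → ℕ, IsStair m a' ∧
      setInd (stairSet a) ∘ Prod.map x.succAbove y.succAbove = setInd (stairSet a') := by
  let L : Finset (Fin m × Fin m) := univ.filter fun p => Prod.map x.succAbove y.succAbove p ∈ stairSet a
  have hL : IsLowerSet ((L : Finset (Fin m × Fin m)) : Set (Fin m × Fin m)) := by
    intro p q hqp hp
    rw [Finset.mem_coe, Finset.mem_filter] at hp ⊢
    refine ⟨mem_univ _, isLowerSet_stairSet ha.1 ?_ hp.2⟩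
    exact ⟨(Fin.strictMono_succAbove x).monotone hqp.1, (Fin.strictMono_succAbove y).monotone hqp.2⟩
  obtain ⟨a', ha', hLa'⟩ := exists_stair_eq_of_isLowerSet L hL
  refine ⟨a', ha', ?_⟩
  funext p
  simp only [Function.comp_apply, setInd_apply, hLa', L, Finset.mem_filter, Finset.mem_univ, true_and]

/-- The reduced grid `(univ ∖ x) × (univ ∖ y)` of `Fin (m+1)` is the image of the full grid of `Fin m` under the `succAbove`
embeddings; so `Ẽ` there is `Ẽ` of the restricted family on the full smaller grid. [this work] -/
theorem et_erase_univ_eq {m n : ℕ} (x y : Fin (m + 1)) (f : Fin n → Fin (m + 1) × Fin (m + 1) → ℝ) :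
    et (@Finset.erase (Fin (m + 1)) (fun a b => Classical.propDecidable (a = b)) univ x)
      (@Finset.erase (Fin (m + 1)) (fun a b => Classical.propDecidable (a = b)) univ y) n f =
      et (univ : Finset (Fin m)) (univ : Finset (Fin m)) n (fun i => f i ∘ Prod.map x.succAbove y.succAbove) := by
  refine et_erase_eq_of_map (Fin.succAboveEmb x) (Fin.succAboveEmb y) univ univ univ univ x y ?_ ?_ n f
  · ext i
    simp [Finset.mem_map, Fin.succAboveEmb]
  · ext i
    simp [Finset.mem_map, Fin.succAboveEmb]

/-! ### Proposition 3.10 for `Ẽ`: the column transposition -/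

/-- **Proposition 3.10 for `Ẽ`.**  If `a = a^k` has descent at `p` but the other sequences of the family do not, then
`Ẽ_n(…,a⁺,…) + Ẽ_n(…,a⁻,…) = 2Ẽ_n(…,a,…)`: `χ_{a⁺} − χ_a` is `χ_a − χ_{a⁻}` moved from column `p` to column `p+1`, the other
staircases are invariant under the transposition of these two columns, and so is `Ẽ` (`et_comp_equiv`). [this work] -/
theorem et_update_aPlus_add_aMinus {n : ℕ} {a : Fin n → Fin m → ℕ} (k : Fin n) {p : ℕ} (hp : p + 1 < m)
    (hflat : ∀ i, i ≠ k → a i (ixL hp) = a i (ixR hp)) :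
    et univ univ n (update (fun i => setInd (stairSet (a i))) k (setInd (stairSet (aPlus (a k) hp)))) +
      et univ univ n (update (fun i => setInd (stairSet (a i))) k (setInd (stairSet (aMinus (a k) hp)))) =
      2 * et univ univ n (fun i => setInd (stairSet (a i))) := by
  set f : Fin n → Fin m × Fin m → ℝ := fun i => setInd (stairSet (a i)) with hf
  -- the two differences
  set u : Fin m × Fin m → ℝ := setInd (stairSet (a k)) - setInd (stairSet (aMinus (a k) hp)) with hu
  set v : Fin m × Fin m → ℝ := setInd (stairSet (aPlus (a k) hp)) - setInd (stairSet (a k)) with hv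
  let τ : Equiv.Perm (Fin m) := Equiv.swap (ixL hp) (ixR hp)
  have hLR : ixL hp ≠ ixR hp := fun h => by
    have := congrArg Fin.val h
    simp [ixL, ixR] at this
  -- `v` is `u` with columns `p, p+1` exchanged
  have hvu : v = u ∘ Prod.map τ id := by
    funext z
    obtain ⟨c, y⟩ := z
    simp only [hv, hu, Pi.sub_apply, Function.comp_apply, Prod.map_apply, id, setInd_apply, mem_stairSet]
    by_cases hcR : c = ixR hp
    · subst hcR
      have h1 : τ (ixR hp) = ixL hp := Equiv.swap_apply_right _ _
      simp [h1, aPlus, aMinus]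
    · by_cases hcL : c = ixL hp
      · subst hcL
        have h1 : τ (ixL hp) = ixR hp := Equiv.swap_apply_left _ _
        simp [h1, aPlus, aMinus, hLR, hLR.symm]
      · have h1 : τ c = c := Equiv.swap_apply_of_ne_of_ne hcL hcR
        simp [h1, aPlus, aMinus, hcR, hcL]
  -- the other slots are invariant under the column transposition
  have hfix : ∀ i, i ≠ k → f i ∘ Prod.map τ id = f i := by
    intro i hi
    funext z
    obtain ⟨c, y⟩ := z
    simp only [hf, Function.comp_apply, Prod.map_apply, id, setInd_apply, mem_stairSet]
    by_cases hcR : c = ixR hp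
    · subst hcR
      have h1 : τ (ixR hp) = ixL hp := Equiv.swap_apply_right _ _
      rw [h1, hflat i hi]
    · by_cases hcL : c = ixL hp
      · subst hcL
        have h1 : τ (ixL hp) = ixR hp := Equiv.swap_apply_left _ _
        rw [h1, ← hflat i hi]
      · have h1 : τ c = c := Equiv.swap_apply_of_ne_of_ne hcL hcR
        rw [h1]
  have hfam : (fun i => update f k u i ∘ Prod.map τ id) = update f k v := by
    funext i
    by_cases hi : i = k
    · subst hi
      rw [update_self, update_self, hvu]
    · rw [update_of_ne hi, update_of_ne hi, hfix i hi]
  have hswap : et univ univ n (update f k v) = et univ univ n (update f k u) := by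
    rw [← hfam]
    exact et_comp_equiv τ (Equiv.refl (Fin m)) n (update f k u)
  -- bookkeeping
  have hself : update f k (setInd (stairSet (a k))) = f := by rw [hf, update_eq_self]
  have e1 : et univ univ n (update f k (setInd (stairSet (aPlus (a k) hp)))) =
      et univ univ n f + et univ univ n (update f k v) := by
    have : setInd (stairSet (aPlus (a k) hp)) = setInd (stairSet (a k)) + v := by rw [hv]; abel
    rw [this, et_update_add, hself]
  have e2 : et univ univ n (update f k (setInd (stairSet (aMinus (a k) hp)))) =
      et univ univ n f - et univ univ n (update f k u) := by
    have : setInd (stairSet (aMinus (a k) hp)) = setInd (stairSet (a k)) - u := by rw [hu]; abel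
    rw [this, et_update_sub, hself]
  rw [e1, e2, hswap]
  ring

/-! ### `A(n)`: one slot disjoint from a staircase slot -/

/-- `A(2)` for `Ẽ`: `Ẽ_2(χ_b, χ_S) = 0 − (Σ_z χ·(z)·Ẽ_1^{reduced}(χ·))/m² ≤ 0` when `χ_b χ_S = 0`. [this work] -/
theorem et_disjoint_nonpos_zero (F : Fin 2 → Fin m × Fin m → ℝ) (s t : Fin 2) (hst : s ≠ t) (b : Fin m → ℕ)
    (T : Finset (Fin m × Fin m)) (hbT : Disjoint (stairSet b) T) (hs : F s = setInd (stairSet b))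
    (ht : F t = setInd T) : et univ univ 2 F ≤ 0 := by
  have h01 : (s = 0 ∧ t = 1) ∨ (s = 1 ∧ t = 0) := by
    rcases Fin.eq_zero_or_eq_succ s with hs0 | ⟨s', hs'⟩ <;>
      rcases Fin.eq_zero_or_eq_succ t with ht0 | ⟨t', ht'⟩
    · exact absurd (hs0.trans ht0.symm) hst
    · left
      exact ⟨hs0, by rw [ht', Subsingleton.elim t' 0]; rfl⟩
    · right
      exact ⟨by rw [hs', Subsingleton.elim s' 0]; rfl, ht0⟩
    · exfalso
      apply hst
      rw [hs', ht', Subsingleton.elim s' t']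
  have hbT' : stairSet b ∩ T = ∅ := Finset.disjoint_iff_inter_eq_empty.1 hbT
  have hprod : Fin.tail F 0 * F 0 = 0 := by
    show F 1 * F 0 = 0
    rcases h01 with ⟨rfl, rfl⟩ | ⟨rfl, rfl⟩
    · rw [hs, ht, mul_comm, setInd_mul, hbT', setInd_empty_eq_zero']
    · rw [hs, ht, setInd_mul, hbT', setInd_empty_eq_zero']
  have h0 : ∀ z, 0 ≤ F 0 z := by
    rcases h01 with ⟨rfl, rfl⟩ | ⟨rfl, rfl⟩
    · rw [hs]; exact fun z => setInd_nonneg _ _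
    · rw [ht]; exact fun z => setInd_nonneg _ _
  have h1 : ∀ z, 0 ≤ F 1 z := by
    rcases h01 with ⟨rfl, rfl⟩ | ⟨rfl, rfl⟩
    · rw [ht]; exact fun z => setInd_nonneg _ _
    · rw [hs]; exact fun z => setInd_nonneg _ _
  rw [et_succ_succ, Fin.sum_univ_one, hprod, et_update_zero, zero_sub, neg_nonpos]
  refine div_nonneg (sum_nonneg fun z _ => mul_nonneg (h0 z) ?_) (by positivity)
  rw [et_one]
  exact div_nonneg (sum_nonneg fun z' _ => h1 z') (by positivity)

/-- **The step `A(n−1) ∧ C(n−1) ⟹ A(n)` for `Ẽ`** (all grid sizes at once): peel `χ_S`; the `χ_b`-term vanishes, the staircase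
terms are `≤ 0` by `A(n−1)` on the same grid, and the product term is an average of `Ẽ_{n−1}` of RESTRICTED staircases over the
reduced grids, `≥ 0` by `C(n−1)` on the smaller grid. [this work] -/
theorem et_disjoint_nonpos_succ (k : ℕ)
    (hC : ∀ (m : ℕ) (a : Fin (k + 2) → Fin m → ℕ), k + 2 ≤ m → (∀ i, IsStair m (a i)) →
      0 ≤ et univ univ (k + 2) (fun i => setInd (stairSet (a i))))
    (hA : ∀ (m : ℕ) (F : Fin (k + 2) → Fin m × Fin m → ℝ) (s t : Fin (k + 2)), s ≠ t → ∀ (b : Fin m → ℕ)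
      (T : Finset (Fin m × Fin m)), k + 2 ≤ m → IsStair m b → Disjoint (stairSet b) T → F s = setInd (stairSet b) →
      F t = setInd T → (∀ i, i ≠ s → i ≠ t → ∃ a, IsStair m a ∧ F i = setInd (stairSet a)) →
      et univ univ (k + 2) F ≤ 0)
    (m : ℕ) (F : Fin (k + 3) → Fin m × Fin m → ℝ) (s t : Fin (k + 3)) (hst : s ≠ t) (b : Fin m → ℕ)
    (T : Finset (Fin m × Fin m)) (hm : k + 3 ≤ m) (hb : IsStair m b) (hbT : Disjoint (stairSet b) T)
    (hs : F s = setInd (stairSet b)) (ht : F t = setInd T)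
    (hrest : ∀ i, i ≠ s → i ≠ t → ∃ a, IsStair m a ∧ F i = setInd (stairSet a)) :
    et univ univ (k + 3) F ≤ 0 := by
  -- the grid is a successor grid
  obtain ⟨m, rfl⟩ : ∃ m', m = m' + 1 := ⟨m - 1, by omega⟩
  -- First the case `t = 0` (the recursion peels slot `0`).
  have main : ∀ (G : Fin (k + 3) → Fin (m + 1) × Fin (m + 1) → ℝ) (s : Fin (k + 3)), s ≠ 0 →
      G s = setInd (stairSet b) → G 0 = setInd T →
      (∀ i, i ≠ s → i ≠ 0 → ∃ a, IsStair (m + 1) a ∧ G i = setInd (stairSet a)) →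
      et univ univ (k + 3) G ≤ 0 := by
    intro G s hs0 hGs hG0 hGrest
    obtain ⟨s', rfl⟩ := Fin.exists_succ_eq.2 hs0
    have htail : ∀ i : Fin (k + 2), ∃ a, IsStair (m + 1) a ∧ Fin.tail G i = setInd (stairSet a) := by
      intro i
      by_cases hi : i = s'
      · exact ⟨b, hb, by rw [hi]; exact hGs⟩
      · exact hGrest i.succ (fun h => hi (Fin.succ_injective _ h)) (Fin.succ_ne_zero i)
    choose a ha haG using htail
    have htailEq : Fin.tail G = fun i => setInd (stairSet (a i)) := funext haG
    have hterms : ∀ i : Fin (k + 2),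
        et univ univ (k + 2) (update (Fin.tail G) i (Fin.tail G i * G 0)) ≤ 0 := by
      intro i
      by_cases hi : i = s'
      · subst hi
        have hzero : Fin.tail G i * G 0 = 0 := by
          rw [show Fin.tail G i = G i.succ from rfl, hGs, hG0, setInd_mul,
            Finset.disjoint_iff_inter_eq_empty.1 hbT, setInd_empty_eq_zero']
        rw [hzero, et_update_zero]
      · have hprod : Fin.tail G i * G 0 = setInd (stairSet (a i) ∩ T) := by
          rw [haG i, hG0, setInd_mul]
        rw [hprod]
        refine hA (m + 1) _ s' i (Ne.symm hi) b (stairSet (a i) ∩ T) (by omega) hb ?_ ?_ ?_ ?_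
        · exact Finset.disjoint_of_subset_right Finset.inter_subset_right hbT
        · rw [update_of_ne (Ne.symm hi)]
          exact hGs
        · rw [update_self]
        · intro j hjs hji
          refine ⟨a j, ha j, ?_⟩
          rw [update_of_ne hji]
          exact haG j
    rw [et_succ_succ, sub_nonpos]
    refine (sum_nonpos fun i _ => hterms i).trans ?_
    -- the product term: restricted staircases on the reduced grids, `≥ 0` by `C(n−1)` on the smaller grid
    refine div_nonneg (sum_nonneg fun z _ => mul_nonneg ?_ ?_) (by positivity)
    · rw [hG0]; exact setInd_nonneg _ _
    · rw [et_erase_univ_eq, htailEq]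
      have hres : ∀ i, ∃ a' : Fin m → ℕ, IsStair m a' ∧
          setInd (stairSet (a i)) ∘ Prod.map z.1.succAbove z.2.succAbove = setInd (stairSet a') :=
        fun i => exists_stair_comp_succAbove (ha i) z.1 z.2
      choose a' ha' haa' using hres
      have hfam : (fun i => (fun i => setInd (stairSet (a i))) i ∘ Prod.map z.1.succAbove z.2.succAbove) =
          fun i => setInd (stairSet (a' i)) := funext haa'
      rw [hfam]
      exact hC m a' (by omega) ha'
  -- General position of `t`: move it to slot `0` by the transposition `(0 t)`.
  let σ : Equiv.Perm (Fin (k + 3)) := Equiv.swap t 0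
  have hσ0 : σ 0 = t := Equiv.swap_apply_right _ _
  have hσt : σ t = 0 := Equiv.swap_apply_left _ _
  rw [← et_comp_perm (k + 3) univ univ σ F]
  refine main (fun i => F (σ i)) (σ s) ?_ ?_ ?_ ?_
  · intro h
    apply hst
    have := congrArg σ h
    rwa [Equiv.swap_apply_self, hσ0] at this
  · show F (σ (σ s)) = _
    rw [Equiv.swap_apply_self]
    exact hs
  · show F (σ 0) = _
    rw [hσ0]
    exact ht
  · intro i his hi0
    refine hrest (σ i) (fun h => his ?_) (fun h => hi0 ?_)
    · rw [← h, Equiv.swap_apply_self]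
    · have h' := congrArg σ h
      rwa [Equiv.swap_apply_self, hσt] at h'

/-! ### `A(n) ⟹ B(n)`: starring the sequence with the larger entry -/

/-- **Theorem 3.12 for `Ẽ`** from `A(n)`: if `b = a^j` and `c = a^l` (`j ≠ l`) have descent at `i` and `b_{i+1} ≤ c_{i+1}` then
replacing `c` by `c⋆` does not increase `Ẽ_n` (`χ_{c⋆} − χ_c = χ_S` with `χ_S χ_b = 0` by Lemma 2.7). [this work] -/
theorem et_update_aStar_le {n : ℕ} (hn : n ≤ m)
    (hA : ∀ (F : Fin n → Fin m × Fin m → ℝ) (s t : Fin n), s ≠ t → ∀ (b : Fin m → ℕ)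
      (T : Finset (Fin m × Fin m)), n ≤ m → IsStair m b → Disjoint (stairSet b) T → F s = setInd (stairSet b) →
      F t = setInd T → (∀ i, i ≠ s → i ≠ t → ∃ a, IsStair m a ∧ F i = setInd (stairSet a)) →
      et univ univ n F ≤ 0)
    {a : Fin n → Fin m → ℕ} (ha : ∀ i, IsStair m (a i)) {j l : Fin n} (hjl : j ≠ l) {p : ℕ} (hp : p + 1 < m)
    (hle : a j (ixR hp) ≤ a l (ixR hp)) :
    et univ univ n (update (fun i => setInd (stairSet (a i))) l (setInd (stairSet (aStar (a l) hp)))) ≤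
      et univ univ n (fun i => setInd (stairSet (a i))) := by
  set f : Fin n → Fin m × Fin m → ℝ := fun i => setInd (stairSet (a i)) with hf
  have hself : update f l (setInd (stairSet (a l))) = f := by rw [hf, update_eq_self]
  rw [setInd_stairSet_aStar hp, et_update_add, hself, add_le_iff_nonpos_right]
  refine hA _ j l hjl (a j) (stairSet (aStar (a l) hp) \ stairSet (a l)) hn (ha j) ?_ ?_ ?_ ?_
  · rw [Finset.disjoint_left]
    intro x hxb hxD
    rw [Finset.mem_sdiff] at hxD
    have hx : x ∈ stairSet (aStar (a l) hp) ∩ stairSet (a j) := Finset.mem_inter.2 ⟨hxD.1, hxb⟩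
    rw [← stairSet_inf, aStar_inf_eq hp hle, stairSet_inf] at hx
    exact hxD.2 (Finset.mem_inter.1 hx).1
  · rw [update_of_ne hjl]
  · rw [update_self]
  · intro i hij hil
    exact ⟨a i, ha i, by rw [update_of_ne hil]⟩

end Grid

end SahiTwoChain

end Summit.CriticalPhenomena.PercolationContinuityZ3.Theorems
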